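import Summits.BirchSwinnertonDyer.Rank1Residual.Additive.TameBranchTwoValueRankOne
import Summits.BirchSwinnertonDyer.Rank1Residual.Additive.TwistPartnerForcedTowerJoin
import Summits.BirchSwinnertonDyer.Rank1Residual.Additive.GordRankOneKatoUpperBound
import HarnessLib

/-!
# THE SIMPLE-ZERO CERTIFICATE on defect 3, 4, 6: rank-one rows with `λ_an ≥ 2` — Schneider from the
# typed Kato half and `[T¹]B ≠ 0`, the sign from TWO values (type-free), the non-vanishing from ONE
# Riemann sum beyond the truncation error (cell `b2b-bsdres`, sub-cell additive-p2 =
# X3♯(G-ord)/X4♯(G-ord), gen 28; part 5)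

HONEST FRAMING (cell `b2b-bsdres`, run/shared/lean/b2b/bsd-rank1-residual/, verbatim in every
file): the goal of the cell is to DELETE the COMBINATION-SHAPED residual classes of the
Birch–Swinnerton-Dyer formula for ALL analytic-rank `≤ 1` elliptic curves over `ℚ` — "full BSD
formula for every rank `≤ 1` curve in class `C`" assembled STRICTLY from published theorems — so
that the rank-`≤ 1` remainder becomes exactly the CONSTRUCTION-SHAPED classes, which are TYPED
(missing-input `Prop`s), NOT attempted. This is not "finishing BSD". Sub-cell additive-p2: the
classes X3♯(G-ord) / X4♯(G-ord) are CONSTRUCTION-SHAPED and stay so; labels / RESIDUAL-MAP marks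
UNCHANGED; nothing is booked. Theorems only; the named facts enter as hypothesis binders
(`Delbourgo1998.thm1_exists_bounded_evenMeasure` A282, `Delbourgo2002.mainTheorem` A175,
`Delbourgo2002.thmC_charIdeal_dvd_tameBranch` A227, `Delbourgo2002.mainTheorem_potMult`, GZK).
No definition, no `sorry`.

## What and why

Every rank-one certificate of gens 24–28 on defect 3, 4, 6 read the FIRST TOP coefficient of the
tame branch (`λ_an = 1`: unit Riemann sum, one value, two values). On rows with `λ_an ≥ 2` at
`ord_{s=1}L(E,s) = 1` (window: 175a1, 6650bi1, 19950dh1 @5; 10878bk1, 11760bb1 @7; and 13230bf1@7)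
`CharLamLeAt W p λ_an` does not give Schneider. But Schneider needs only a SIMPLE analytic zero: with the
typed Kato half `ι g = p^k·B` (`TameBranchRatDvdAt`, Delbourgo 2002 (C)) and Delbourgo 2002 (B) clause 1
(`rank ≤ ord_T fE`), `[T¹]B ≠ 0` forces `ord_T fE = 1 = rank`, hence `Reg_p ≠ 0` and `#Ш[p^∞] < ∞`
(clause 2) — gen 19's WEAK certificate (`schneider_and_padicVal_le_rankOne_of_iota_eq`, there for the
`I₀*` branch) moved to the tame branch. The linear coefficient is INVISIBLE to the wild twisted symbol
sums when `λ_an ≥ 2` (the first top coefficient dominates at every available radius `‖κ(γ)−1‖ ≥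
p^{−1/(p−1)}`), so its non-vanishing is certified by gen 24's Riemann sum of the forced partner: the
truncation bound `‖[T¹]B − RS 1 n‖ ≤ p^c·p⁻ⁿ` makes `‖RS 1 n‖ > p^{c−n}` a certificate of `[T¹]B ≠ 0`.
Which forced partner (character `χ` or `χ⁻¹`) is the bounded one is decided TYPE-FREE by this
generation's two values.

* §9 `schneider_and_finite_of_tameBranchRatDvdAt_of_coeff_one_ne_zero` — the core (every defect,
  (M) included): `TameBranchRatDvdAt W p` + ANY tuple `(f, ε, α, B)` of the package with `[T¹]B ≠ 0` +
  `rank = 1` + a (B)-datum ⟹ Schneider ∧ `#Ш[p^∞] < ∞`.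
* §10 `pow_eq_inv_of_orderOf`, **`towerBounded_forced_pow_of_thm1_of_two_norm_ratTwistedSymbolSum`**
  (TYPE-FREE sign in forced-partner currency: two values on line `t ∈ {1, e−1}`, `e·k < 2φₙ` ⟹ the
  forced partner of `(χ^t, ã)` is tower-bounded — `χ^1 = χ` by gen 26/§4-mirror, `χ^{e−1} = χ⁻¹` by
  part 3 §6b).
* §11 **`exists_schneider_rankOne_of_thm1_of_two_norm_ratTwistedSymbolSum_of_lt_norm_riemannSum`**:
  Delbourgo 1998 Thm 1, 2002 (A)(B)(C), GZK + (G)-field / unit root `ã` + `χ = ω^u` + tower bound `p^c` +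
  TWO values on line `t` with ANY `k` (`e·k < 2φₙ`) + ONE Riemann sum of the forced partner of `(χ^t, ã)`
  with **`p^c·p⁻ⁿ < ‖RS 1 n‖`** ⟹ Schneider for every (B)-datum; `ClassX4Gord.…` (`c = 0`: `p⁻ⁿ < ‖RS 1 n‖`,
  i.e. `ord_p RS(1,n) < n`).

EVIDENCE (not an input): gen 23/24's E-FORCED engine computed `[T¹]B` on the 13 window rows as Riemann
sums at two consecutive levels (identical values; `v_p([T¹]B·log_p γ) = 2, 2, 3, 2, 2` on 175a1,
6650bi1, 19950dh1, 10878bk1, 11760bb1 — HOME/b2b-bsdres-additive-p2/gen23/ENGINE-FORCED-PARTNER.md §4,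
gen24/ENGINE-2.md): `[T¹]B ≠ 0` on all five `λ_an ≥ 2` rows; their sign is certified by this gen's two
values (gen28/TWO-VALUE-READING.md). Nothing booked; labels UNCHANGED.

Not claimed: `μ`; the valuation IDENTITY on these rows (only Delbourgo's inequality with the extra
zeros' contribution would follow); the LOWER half; any booking.

References: Delbourgo 1998 Thm. 1 [Delbourgo1998]; Delbourgo 2002 Thm. (A)(B)(C) [Delbourgo2002];
Stein–Wuthrich 2013 §3 (Riemann sums) [SteinWuthrich2013]; MTT 1986 §I.10–I.14
[MazurTateTeitelbaum1986Invent]; Lang Ch. 1 §2 Thm. 2.1 [Lang1990]; [Manin1972]. -/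

set_option autoImplicit false

noncomputable section

open scoped Classical MatrixGroups ModularForm NumberField

open CongruenceSubgroup IsDedekindDomain WeierstrassCurve NumberField
  Literature.NumberTheory.EllipticCurves
  Literature.NumberTheory.EllipticCurves.ModularForms
  Literature.NumberTheory.EllipticCurves.Rank1Residual
  Literature.NumberTheory.EllipticCurves.Rank1Residual.Typed
  Literature.NumberTheory.EllipticCurves.Delbourgo2002
  Summit.BirchSwinnertonDyer.Rank1Residual.X1.MuLambda
  Summit.BirchSwinnertonDyer.Rank1Residual.X11a.LambdaNorm

namespace Summit.BirchSwinnertonDyer.Rank1Residual.Additive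

/-! ### §9 The core: Schneider from the typed Kato half and a SIMPLE analytic zero -/

section Core

variable {W : WeierstrassCurve ℚ} [W.IsElliptic] [W.IsGloballyMinimal] {p : ℕ} [hp : Fact p.Prime]
  {N : ℕ} [NeZero N] {f : CuspForm (Gamma0 N) 2}

/-- **SCHNEIDER FROM THE TYPED KATO HALF AND `[T¹]B ≠ 0`** (every defect, (M) included). `p ≠ 2`
additive of type (M) or (G-ord), `TameBranchRatDvdAt W p` (Delbourgo 2002 (C): `ι g = p^k·B`,
`g ∈ char_Λ X`), ANY tuple `(f, ε, α, B)` with `IsTameBranchOf f p ε α B`, `orderOf ε = tameDefect`,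
`‖α‖ = 1` and **`[T¹]B ≠ 0`**, `rank_ℤ E(ℚ) = 1` and a (B)-datum `Dh`: then `Reg_p(E, Dh) ≠ 0`
(Schneider) and `Ш(E/ℚ)[p^∞]` is finite — by (B) clause 1 `ord_T fE ≥ 1` and `[T¹](fE·h) = [T¹]fE·h(0) =
p^k[T¹]B ≠ 0`, so `ord_T fE = 1` and clause 2 applies (gen 19's `schneider_and_padicVal_le_rankOne_of_iota_eq`
with `u·ϖ = p^k`). NO `λ`-certificate: valid on rows with `λ_an ≥ 2`.
[cite: Delbourgo2002, Theorem (A), (B), (C) (p. 40)] -/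
theorem schneider_and_finite_of_tameBranchRatDvdAt_of_coeff_one_ne_zero (hT : TameBranchRatDvdAt W p)
    {ε : DirichletCharacter ℂ_[p] p} {α : ℚ_[p]} {B : PowerSeries ℚ_[p]}
    (hp2 : p ≠ 2) (hadd : Addv W p) (hloc : PotMult W p ∨ TypeGOrd W p)
    (hf : IsNewformOf W f) (hε : orderOf ε = tameDefect W p) (hα : ‖α‖ = 1)
    (hB : IsTameBranchOf f p ε α B) (hne : PowerSeries.coeff 1 B ≠ 0)
    (hr1 : W.mordellWeilRank = 1) {Dh : PAdicHeightData W p} (hBcl : LeadingTermClauses W p Dh) :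
    SchneiderConjecture Dh ∧ Finite (AddCommGroup.primaryComponent W.sha p) := by
  obtain ⟨κ, hκ, γ, hγ, hγ'⟩ := exists_isCyclotomic_isTopGenerator_isCyclotomicVariable_holds p
  obtain ⟨D⟩ := W.nonempty_selmerDualData_holds κ γ hγ
  haveI : Module.Finite (IwasawaAlgebra p) D.X := D.module_finite_holds hγ
  haveI : (Module.charIdeal (IwasawaAlgebra p) D.X).IsPrincipal := charIdeal_isPrincipal_holds p D.X
  obtain ⟨fE, hchar⟩ := Submodule.IsPrincipal.principal (Module.charIdeal (IwasawaAlgebra p) D.X)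
  have hchar' : D.charIdeal = Ideal.span {fE} := hchar
  obtain ⟨hX, g, hg, k, hι⟩ := hT ε α B hp2 hadd hloc hκ hγ hγ' hf hε hα hB D
  have hp0 : (p : ℚ_[p]) ≠ 0 := Nat.cast_ne_zero.mpr hp.out.ne_zero
  have hι' : iwasawaToPowerSeries p g =
      PowerSeries.C ((((1 : ℤ_[p]ˣ) : ℤ_[p]) : ℚ_[p]) * ((((p : ℚ) ^ k : ℚ)) : ℚ_[p])) * B := by
    rw [hι]; congr 2; push_cast; simp
  have hne' : PowerSeries.coeff 1 (PowerSeries.C ((((p : ℚ) ^ k : ℚ)) : ℚ_[p]) * B) ≠ 0 := by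
    rw [PowerSeries.coeff_C_mul]
    refine mul_ne_zero ?_ hne
    push_cast
    exact pow_ne_zero _ hp0
  obtain ⟨hS, hfin, -⟩ := schneider_and_padicVal_le_rankOne_of_iota_eq hp2 hr1 hBcl hκ hγ hγ' D hX
    hchar' hg hι' hne'
  exact ⟨hS, hfin⟩

end Core

/-! ### §10 The sign, type-free, in forced-partner currency: the forced partner of `(χ^t, ã)` -/

namespace TwistPartner

open TameBranchOneValue TameBranchTwoValue

section Sign

variable {W : WeierstrassCurve ℚ} [W.IsElliptic] [W.IsGloballyMinimal] {p : ℕ} [hp : Fact p.Prime]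
  {N : ℕ} [NeZero N] {f : CuspForm (Gamma0 N) 2} {χ : MulChar (ZMod p) ℚ_[p]} {ã : ℚ_[p]}

/-- `χ^{e−1} = χ⁻¹` when `orderOf χ = e ≥ 1`. [folklore] -/
theorem pow_sub_one_eq_inv_of_orderOf {e : ℕ} (hχe : orderOf χ = e) (he : 1 ≤ e) :
    χ ^ (e - 1) = χ⁻¹ := by
  refine eq_inv_of_mul_eq_one_left ?_
  rw [← pow_succ, Nat.sub_add_cancel he, ← hχe, pow_orderOf_eq_one]

/-- `orderOf (χ^t) = orderOf χ` for `t ∈ {1, orderOf χ − 1}` (`orderOf χ ≥ 1`). [folklore] -/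
theorem orderOf_pow_eq_of_mem {e t : ℕ} (hχe : orderOf χ = e) (he : 1 ≤ e) (ht : t = 1 ∨ t = e - 1) :
    orderOf (χ ^ t) = e := by
  rcases ht with rfl | rfl
  · rw [pow_one, hχe]
  · rw [pow_sub_one_eq_inv_of_orderOf hχe he, orderOf_inv, hχe]

/-- **THE SIGN, TYPE-FREE, forced-partner currency (Delbourgo 1998 Thm 1 + two values).** Setting of
`towerBounded_forced_or_inv_of_thm1` (ADDITIVE, `p ≥ 5`, `e ∈ {3,4,6}`, (G)-field `F`, `w ∣ p`, THE
unit root `ã`), `χ = ω^u` the Teichmüller power of the SMALL exponent of order `e`, tower bound `p^c`,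
and TWO even primitive `p`-power-order characters `κ`, `κ'` at conductors `p^{n+1+e₀}`, `p^{n+2+e₀}` whose
twisted symbol sums lie on ONE line `t ∈ {1, e−1}` with a common `k`, `e·k < 2φₙ`. Then the forced
partner of **`(χ^t, ã)`** is bounded on the tower (`t = 1`: a bounded partner of `χ⁻¹` is refuted at
the next conductor; `t = e−1`: part 3 §6b). Nothing booked. [cite: Delbourgo1998, Theorem 1 (p. 131)]
[cite: Lang1990, Ch. 1 §2 Thm. 2.1] [cite: MazurTateTeitelbaum1986Invent, §I.8, §I.10–I.14] -/
theorem towerBounded_forced_pow_of_thm1_of_two_norm_ratTwistedSymbolSum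
    (hD : Delbourgo1998.thm1_exists_bounded_evenMeasure)
    (h5 : 5 ≤ p) (hadd : Addv W p) (he : semistabilityIndex W p ∈ ({3, 4, 6} : Finset ℕ))
    (hf : IsNewformOf W f)
    {L : Type} [Field L] [NumberField L] [IsCyclotomicExtension {p} ℚ L] (F : IntermediateField ℚ L)
    (hF : ∀ w : HeightOneSpectrum (𝓞 F), (p : 𝓞 F) ∈ w.asIdeal →
      (W.baseChange F).HasGoodReductionAt w ∧ (W.baseChange F).HasUnitRootAt w)
    (w : HeightOneSpectrum (𝓞 F)) (hw : (p : 𝓞 F) ∈ w.asIdeal)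
    (hã : ‖ã‖ = 1) (hroot : ã ^ 2 - (((W.baseChange F).frobeniusTraceAt w : ℤ) : ℚ_[p]) * ã + p = 0)
    (hχe : orderOf χ = semistabilityIndex W p) {u : ℕ} (hu : semistabilityIndex W p * u = p - 1)
    (hteich : ∀ a : ZMod p, a ≠ 0 → ‖χ a - ((a.val : ℕ) : ℚ_[p]) ^ u‖ < 1) {c : ℕ}
    (hc : ∀ (m : ℕ) (a : ℤ), ‖((ratPlusSymbol f ((a : ℚ) / (p : ℚ) ^ m) : ℚ) : ℚ_[p])‖ ≤ (p : ℝ) ^ c)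
    {n : ℕ} {κ : DirichletCharacter ℂ_[p] (p ^ (n + 1 + cyclotomicExponent p))} (hκ : κ.IsPrimitive)
    (heven : κ.Even) (hord : ∃ j : ℕ, orderOf κ = p ^ j)
    {κ' : DirichletCharacter ℂ_[p] (p ^ (n + 1 + 1 + cyclotomicExponent p))} (hκ' : κ'.IsPrimitive)
    (heven' : κ'.Even) (hord' : ∃ j : ℕ, orderOf κ' = p ^ j) {k t : ℕ}
    (ht : t = 1 ∨ t = semistabilityIndex W p - 1)
    (hk2 : semistabilityIndex W p * k < 2 * Nat.totient (p ^ (n + 1)))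
    (hval : ‖ratTwistedSymbolSum f κ‖ ^ (semistabilityIndex W p * Nat.totient (p ^ (n + 1))) =
      ((p : ℝ) ^ c) ^ (semistabilityIndex W p * Nat.totient (p ^ (n + 1))) *
        ((p : ℝ)⁻¹) ^ (semistabilityIndex W p * k + t * Nat.totient (p ^ (n + 1))))
    (hval' : ‖ratTwistedSymbolSum f κ'‖ ^ (semistabilityIndex W p * Nat.totient (p ^ (n + 1 + 1))) =
      ((p : ℝ) ^ c) ^ (semistabilityIndex W p * Nat.totient (p ^ (n + 1 + 1))) *
        ((p : ℝ)⁻¹) ^ (semistabilityIndex W p * k + t * Nat.totient (p ^ (n + 1 + 1)))) :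
    ∃ C₀ : ℝ, ∀ (m : ℕ) (a : ℤ),
      ‖forced (χ ^ t) (fun r ↦ ((ratPlusSymbol f r : ℚ) : ℚ_[p])) ã ((a : ℚ) / (p : ℚ) ^ m)‖ ≤ C₀ := by
  have h3 : 3 ≤ semistabilityIndex W p := three_le_of_mem he
  rcases ht with rfl | rfl
  · rw [pow_one]
    rw [one_mul] at hval'
    rcases towerBounded_forced_or_inv_of_thm1 hD h5 hadd he hf F hF w hw hã hroot hχe with hbd | ⟨C₁, hC₁⟩
    · exact hbd
    · exfalso
      have hχ : χ⁻¹ ≠ χ := inv_ne_self_of_orderOf_mem he hχe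
      have hχ1' : χ⁻¹ ≠ 1 := fun h ↦ hχ (by rw [h]; exact (inv_eq_one.mp h).symm)
      have hU0 := sum_ratPlusSymbol_add_div_eq_zero_of_addv W hf hadd
      obtain ⟨B', hB', hint⟩ := exists_isTameBranchOf_of_towerBounded_forced hχ1' hã hU0 hC₁
      exact hB'.false_of_norm_ratTwistedSymbolSum_pow_eq_inv_succ hã (hint _ hc) hteich hχe h3 hu hκ'
        heven' hord' hk2 hval'
  · rw [pow_sub_one_eq_inv_of_orderOf hχe (by omega)]
    exact towerBounded_forced_inv_of_thm1_of_norm_ratTwistedSymbolSum_inv_succ hD h5 hadd he hf F hF w hw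
      hã hroot hχe hu hteich hc hκ heven hord hκ' heven' hord' hk2 hval hval'

end Sign

/-! ### §11 Rank one with `λ_an ≥ 2`: Schneider from two values and ONE Riemann sum beyond the
truncation error -/

section SimpleZero

variable {W : WeierstrassCurve ℚ} [W.IsElliptic] [W.IsGloballyMinimal] {p : ℕ} [hp : Fact p.Prime]
  {N : ℕ} [NeZero N] {f : CuspForm (Gamma0 N) 2} {χ : MulChar (ZMod p) ℚ_[p]} {ã : ℚ_[p]} {t : ℕ}
  {RS : ℕ → ℕ → ℚ_[p]}
  (hRS : ∀ k n : ℕ, RS k n =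
      ∑ᶠ ξ : rootsOfUnity (Literature.NumberTheory.EllipticCurves.torsionOrder p) ℤ_[p],
        ∑ s : ZMod (p ^ n),
        twistPartnerMeasure (χ ^ t)
            (TwistPartner.forced (χ ^ t) (fun r ↦ ((ratPlusSymbol f r : ℚ) : ℚ_[p])) ã) ã
            ((ratPlusSymbol f 0 : ℚ) : ℚ_[p]) (n + cyclotomicExponent p)
            (PadicInt.toZModPow (n + cyclotomicExponent p) ((ξ : ℤ_[p]ˣ) : ℤ_[p]) *
              (cyclotomicGenerator p : ZMod (p ^ (n + cyclotomicExponent p))) ^ s.val) *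
          ((s.val.choose k : ℕ) : ℚ_[p]))

include hRS

/-- **`ord_{s=1}L(E,s) = 1`, ANY `λ_an`: Schneider for Delbourgo's datum FROM PRINT, TWO VALUES AND ONE
RIEMANN SUM.** `p ≥ 5`, ADDITIVE, (G)-ordinary, non-CM, `e ∈ {3,4,6}`; Delbourgo 1998 Thm 1, 2002
(A)(B)(C), GZK; a (G)-field `F` with `w ∣ p` and THE unit root `ã`; `χ = ω^u` of order `e`; tower bound
`p^c`; TWO even primitive `p`-power-order characters at conductors `p^{n+1+e₀}`, `p^{n+2+e₀}` whose twisted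
symbol sums lie on ONE line `t ∈ {1, e−1}` with a common `k` (ANY `k`, `e·k < 2φₙ` — the sign); and
ONE Riemann sum of the forced partner of `(χ^t, ã)` at some level `n₁` with **`p^c·p^{−n₁} < ‖RS 1 n₁‖_p`**
(the truncation error is beaten: `[T¹]B ≠ 0`). Then Schneider's conjecture holds for every (B)-datum,
and one exists. Valid on rows with `λ_an ≥ 2`, where no `λ`-certificate gives Schneider. Nothing booked.
[cite: Delbourgo1998, Theorem 1 (p. 131)] [cite: Delbourgo2002, Theorem (A), (B), (C) (p. 40)]
[cite: SteinWuthrich2013, §3] [cite: MazurTateTeitelbaum1986Invent, §I.10–I.14] -/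
theorem exists_schneider_rankOne_of_thm1_of_two_norm_ratTwistedSymbolSum_of_lt_norm_riemannSum
    (hD : Delbourgo1998.thm1_exists_bounded_evenMeasure)
    (hC : Delbourgo2002.thmC_charIdeal_dvd_tameBranch) (hDel : Delbourgo2002.mainTheorem)
    (hDelM : Delbourgo2002.mainTheorem_potMult) (hGZK : rank_eq_analyticRank_of_analyticRank_le_one)
    (h5 : 5 ≤ p) (hcm : ¬ W.HasCM) (hadd : Addv W p) (hGord : TypeGOrd W p)
    (he : semistabilityIndex W p ∈ ({3, 4, 6} : Finset ℕ)) (hr : W.analyticRank = 1)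
    (hf : IsNewformOf W f)
    {L : Type} [Field L] [NumberField L] [IsCyclotomicExtension {p} ℚ L] (F : IntermediateField ℚ L)
    (hF : ∀ w : HeightOneSpectrum (𝓞 F), (p : 𝓞 F) ∈ w.asIdeal →
      (W.baseChange F).HasGoodReductionAt w ∧ (W.baseChange F).HasUnitRootAt w)
    (w : HeightOneSpectrum (𝓞 F)) (hw : (p : 𝓞 F) ∈ w.asIdeal)
    (hã : ‖ã‖ = 1) (hroot : ã ^ 2 - (((W.baseChange F).frobeniusTraceAt w : ℤ) : ℚ_[p]) * ã + p = 0)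
    (hχe : orderOf χ = semistabilityIndex W p) {u : ℕ} (hu : semistabilityIndex W p * u = p - 1)
    (hteich : ∀ a : ZMod p, a ≠ 0 → ‖χ a - ((a.val : ℕ) : ℚ_[p]) ^ u‖ < 1) {c : ℕ}
    (hc : ∀ (m : ℕ) (a : ℤ), ‖((ratPlusSymbol f ((a : ℚ) / (p : ℚ) ^ m) : ℚ) : ℚ_[p])‖ ≤ (p : ℝ) ^ c)
    {n : ℕ} {κ : DirichletCharacter ℂ_[p] (p ^ (n + 1 + cyclotomicExponent p))} (hκ : κ.IsPrimitive)
    (heven : κ.Even) (hord : ∃ j : ℕ, orderOf κ = p ^ j)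
    {κ' : DirichletCharacter ℂ_[p] (p ^ (n + 1 + 1 + cyclotomicExponent p))} (hκ' : κ'.IsPrimitive)
    (heven' : κ'.Even) (hord' : ∃ j : ℕ, orderOf κ' = p ^ j) {k : ℕ}
    (ht : t = 1 ∨ t = semistabilityIndex W p - 1)
    (hk2 : semistabilityIndex W p * k < 2 * Nat.totient (p ^ (n + 1)))
    (hval : ‖ratTwistedSymbolSum f κ‖ ^ (semistabilityIndex W p * Nat.totient (p ^ (n + 1))) =
      ((p : ℝ) ^ c) ^ (semistabilityIndex W p * Nat.totient (p ^ (n + 1))) *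
        ((p : ℝ)⁻¹) ^ (semistabilityIndex W p * k + t * Nat.totient (p ^ (n + 1))))
    (hval' : ‖ratTwistedSymbolSum f κ'‖ ^ (semistabilityIndex W p * Nat.totient (p ^ (n + 1 + 1))) =
      ((p : ℝ) ^ c) ^ (semistabilityIndex W p * Nat.totient (p ^ (n + 1 + 1))) *
        ((p : ℝ)⁻¹) ^ (semistabilityIndex W p * k + t * Nat.totient (p ^ (n + 1 + 1))))
    {n₁ : ℕ} (hlt : (p : ℝ) ^ c * (p : ℝ) ^ (-(n₁ : ℤ)) < ‖RS 1 n₁‖) :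
    (∀ Dh : PAdicHeightData W p, LeadingTermClauses W p Dh → SchneiderConjecture Dh) ∧
      ∃ Dh : PAdicHeightData W p, LeadingTermClauses W p Dh ∧ SchneiderConjecture Dh := by
  have hp2 : p ≠ 2 := by omega
  have h3 : 3 ≤ semistabilityIndex W p := three_le_of_mem he
  have hG : SubGord W p := (subGord_iff_typeG_of_addv W p hp2 hadd).mpr hGord.typeG
  have hT : TameBranchRatDvdAt W p := tameBranchRatDvdAt_of_thmC hC hDel hDelM h5 hcm
  -- the sign: the forced partner of `(χ^t, ã)` is tower-bounded
  obtain ⟨C₀, hC₀⟩ := towerBounded_forced_pow_of_thm1_of_two_norm_ratTwistedSymbolSum hD h5 hadd he hf F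
    hF w hw hã hroot hχe hu hteich hc hκ heven hord hκ' heven' hord' ht hk2 hval hval'
  have hordt : orderOf (χ ^ t) = semistabilityIndex W p := orderOf_pow_eq_of_mem hχe (by omega) ht
  have hne1 : χ ^ t ≠ 1 := by
    intro h
    rw [h, orderOf_one] at hordt
    omega
  have hU0 := sum_ratPlusSymbol_add_div_eq_zero_of_addv W hf hadd
  -- the branch of the forced partner, with its truncation bound against the Riemann sums
  obtain ⟨B, hB, hint, hRSle⟩ :=
    exists_isTameBranchOf_riemannSum_of_towerBounded_forced hRS hne1 hã hU0 hC₀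
  -- `[T¹]B ≠ 0`
  have hne : PowerSeries.coeff 1 B ≠ 0 := by
    intro h0
    have hle := hRSle _ hc 1 n₁
    rw [h0, zero_sub, norm_neg, Nat.factorial_one, Nat.cast_one, norm_one, div_one, zpow_neg,
      zpow_natCast] at hle
    rw [zpow_neg, zpow_natCast] at hlt
    exact (lt_irrefl _) (hlt.trans_le hle)
  have hordε : orderOf ((χ ^ t).ringHomComp (algebraMap ℚ_[p] ℂ_[p])) = tameDefect W p := by
    rw [orderOf_ringHomComp_padicComplex, hordt, tameDefect_of_not_potMult W p hG.1]
  obtain ⟨hmw, -⟩ := hGZK W (by rw [hr])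
  have hr1 : W.mordellWeilRank = 1 := by rw [hmw, hr]
  have hS : ∀ Dh : PAdicHeightData W p, LeadingTermClauses W p Dh → SchneiderConjecture Dh :=
    fun Dh hBcl ↦ (schneider_and_finite_of_tameBranchRatDvdAt_of_coeff_one_ne_zero hT hp2 hadd
      (Or.inr hGord) hf hordε hã hB hne hr1 hBcl).1
  obtain ⟨Dh, hBcl⟩ := Delbourgo2002.mainTheorem.exists_leadingTermClauses hDel h5 hcm hadd hGord
  exact ⟨hS, Dh, hBcl, hS Dh hBcl⟩

/-- **X4♯(G-ord), defect 3, 4, 6, `ord_{s=1}L(E,s) = 1`, ANY `λ_an`, `p ≥ 5`, non-CM — SCHNEIDER FROM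
PRINT, TWO VALUES AND ONE RIEMANN SUM** (Drinfeld–Manin `c = 0`): (G)-field / unit root `ã`, `χ = ω^u`,
TWO values `‖S(κ)‖^{eφₙ} = p^{−(ek+tφₙ)}`, `‖S(κ')‖^{eφₙ₊₁} = p^{−(ek+tφₙ₊₁)}` (`t ∈ {1, e−1}`, `e·k < 2φₙ`)
and ONE Riemann sum of the forced partner of `(χ^t, ã)` with **`p^{−n₁} < ‖RS 1 n₁‖_p`**
(`ord_p RS(1,n₁) < n₁`) ⟹ Schneider for every (B)-datum. The rows with `λ_an ≥ 2` of the Gord_e346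
window (10878bk1, 11760bb1 @7 on X4) had no kernel route to Schneider before (every earlier certificate
read the first TOP coefficient). EVIDENCE (not an input): gen 23/24's E-FORCED Riemann sums give
`ord_7([T¹]B·log_7 γ) = 2` on both rows at two consecutive levels. Nothing booked; X4♯(G-ord) stays
CONSTRUCTION-SHAPED. [cite: Delbourgo1998, Theorem 1 (p. 131)]
[cite: Delbourgo2002, Theorem (A), (B), (C) (p. 40)] [cite: Manin1972, Cor. 3.6] [cite: SteinWuthrich2013, §3] -/
theorem ClassX4Gord.exists_schneider_rankOne_of_thm1_of_two_norm_ratTwistedSymbolSum_of_lt_norm_riemannSum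
    (hD : Delbourgo1998.thm1_exists_bounded_evenMeasure)
    (hC : Delbourgo2002.thmC_charIdeal_dvd_tameBranch) (hDel : Delbourgo2002.mainTheorem)
    (hDelM : Delbourgo2002.mainTheorem_potMult) (hGZK : rank_eq_analyticRank_of_analyticRank_le_one)
    (hX : ClassX4Gord W p) (h5 : 5 ≤ p) (hcm : ¬ W.HasCM)
    (he : semistabilityIndex W p ∈ ({3, 4, 6} : Finset ℕ)) (hr : W.analyticRank = 1)
    (hf : IsNewformOf W f)
    {L : Type} [Field L] [NumberField L] [IsCyclotomicExtension {p} ℚ L] (F : IntermediateField ℚ L)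
    (hF : ∀ w : HeightOneSpectrum (𝓞 F), (p : 𝓞 F) ∈ w.asIdeal →
      (W.baseChange F).HasGoodReductionAt w ∧ (W.baseChange F).HasUnitRootAt w)
    (w : HeightOneSpectrum (𝓞 F)) (hw : (p : 𝓞 F) ∈ w.asIdeal)
    (hã : ‖ã‖ = 1) (hroot : ã ^ 2 - (((W.baseChange F).frobeniusTraceAt w : ℤ) : ℚ_[p]) * ã + p = 0)
    (hχe : orderOf χ = semistabilityIndex W p) {u : ℕ} (hu : semistabilityIndex W p * u = p - 1)
    (hteich : ∀ a : ZMod p, a ≠ 0 → ‖χ a - ((a.val : ℕ) : ℚ_[p]) ^ u‖ < 1)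
    {n : ℕ} {κ : DirichletCharacter ℂ_[p] (p ^ (n + 1 + cyclotomicExponent p))} (hκ : κ.IsPrimitive)
    (heven : κ.Even) (hord : ∃ j : ℕ, orderOf κ = p ^ j)
    {κ' : DirichletCharacter ℂ_[p] (p ^ (n + 1 + 1 + cyclotomicExponent p))} (hκ' : κ'.IsPrimitive)
    (heven' : κ'.Even) (hord' : ∃ j : ℕ, orderOf κ' = p ^ j) {k : ℕ}
    (ht : t = 1 ∨ t = semistabilityIndex W p - 1)
    (hk2 : semistabilityIndex W p * k < 2 * Nat.totient (p ^ (n + 1)))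
    (hval : ‖ratTwistedSymbolSum f κ‖ ^ (semistabilityIndex W p * Nat.totient (p ^ (n + 1))) =
      ((p : ℝ)⁻¹) ^ (semistabilityIndex W p * k + t * Nat.totient (p ^ (n + 1))))
    (hval' : ‖ratTwistedSymbolSum f κ'‖ ^ (semistabilityIndex W p * Nat.totient (p ^ (n + 1 + 1))) =
      ((p : ℝ)⁻¹) ^ (semistabilityIndex W p * k + t * Nat.totient (p ^ (n + 1 + 1))))
    {n₁ : ℕ} (hlt : (p : ℝ) ^ (-(n₁ : ℤ)) < ‖RS 1 n₁‖) :
    (∀ Dh : PAdicHeightData W p, LeadingTermClauses W p Dh → SchneiderConjecture Dh) ∧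
      ∃ Dh : PAdicHeightData W p, LeadingTermClauses W p Dh ∧ SchneiderConjecture Dh := by
  have hc : ∀ (m : ℕ) (a : ℤ),
      ‖((ratPlusSymbol f ((a : ℚ) / (p : ℚ) ^ m) : ℚ) : ℚ_[p])‖ ≤ (p : ℝ) ^ (0 : ℕ) := fun m a ↦ by
    rw [pow_zero]
    exact plusSymbolsPIntegralAt_of_classX4 W p hX.1 f hf _
  exact TwistPartner.exists_schneider_rankOne_of_thm1_of_two_norm_ratTwistedSymbolSum_of_lt_norm_riemannSum
    hRS hD hC
    hDel hDelM hGZK h5 hcm hX.addv.2 hX.typeGOrd he hr hf F hF w hw hã hroot hχe hu hteich hc hκ heven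
    hord hκ' heven' hord' ht hk2 (by rw [pow_zero, one_pow, one_mul]; exact hval)
    (by rw [pow_zero, one_pow, one_mul]; exact hval') (by rw [pow_zero, one_mul]; exact hlt)

end SimpleZero

end TwistPartner

end Summit.BirchSwinnertonDyer.Rank1Residual.Additive

end
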